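import Mathlib
import Summits.NavierStokesRegularity.NavierStokesRegularity.Theorems.EulerZoomLiouvillePowerGaugeEulerLiouvilleIrrotationalTools
import HarnessLib.Audit

/-!
# Crux E `PowerGaugeEulerLiouville` (stmt-NavierStokesRegularity-19832): the FROZEN-DIRECTION slice lemma
# (line `frozen-direction`, stub F1 `stub_noVariationAlongDirection`, filled)

Route `EulerZoomLiouville` (NavierStokesRegularity), crux E.  Line `frozen-direction` (crux dir
`Cruxes/PowerGaugeEulerLiouville/Lines/frozen-direction.md`, ns-idea-11 g2: Giga–Miura's continuous-alignment programme read on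
the Euler side of Seregin's power zoom) kills the members whose weak gradient `H` has a FROZEN vorticity direction `e(τ)` on a far
past, `H e = Hᵀ e` a.e.; its load-bearing stub F1 is the SLICE LEMMA proved here, in the stub's binder shape
(`FrozenDirection.ae_apply_eq_zero_of_pairing_traceFree_of_growth`):

> a field `f ∈ L¹_loc(ℝ³; ℝ³)` with weak gradient `G`, trace-free a.e. (`div f = 0`), satisfying the frozen-direction pairing
> `⟪G(x) e, w⟫ = ⟪G(x) w, e⟫` for a.e. `x` and all `w`, with sub-volume growth `∫_{B_r}|f|² ≤ K r^m` (`m < 3`, `r > r₀`), does not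
> vary along `e`: `G(x) e = 0` for a.e. `x`.

Route (the lineage's irrotational slice lemma `ae_eq_zero_of_symm_traceFree_of_growth` with "symmetric for all pairs" replaced by
"symmetric against `e`"): (1) `f` annihilates the curl-type test fields `(∂ₐ g) e − (∂ₑ g) a` (`integral_inner_curlPair_eq_zero_of_pairing`:
the two weak-gradient pairings and the frozen pairing); (2) hence, `f` being weakly divergence free (`isWeaklyDivFree_of_trace_eq_zero`),
the component `⟪f, e⟫` is WEAKLY HARMONIC (`integral_laplacian_mul_inner_eq_zero_of_curlPair_dir`, the tree's Lemarié-Rieusset identity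
`Δθ·a = ∇(∂ₐθ) + Σᵢ curl-pairs(bᵢ, a)` needing only the pairs `(bᵢ, e)`); (3) the growth Liouville
`ae_eq_zero_of_weaklyHarmonic_of_growth` gives `⟪f, e⟫ = 0` a.e.; (4) the weak gradient of an a.e.-vanishing component vanishes:
`⟪G w, e⟫ = 0` a.e. for each `w` (`ae_eq_zero_of_integral_contDiff_smul_eq_zero` on a basis); (5) the pairing turns `Gᵀe = 0` into `G e = 0`.
WHAT THIS IS NOT: not NS regularity, not the crux E — a linear slice lemma for one stratum of the lead skeleton (interim LEAD ns-typeII-p2 g10).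
[folklore; GigaMiura2011 Thm 1.1 (motivation); LemarieRieusset2016 proof of Thm 4.4 (weak harmonicity from div/curl)]
-/

noncomputable section

set_option linter.dupNamespace false

open MeasureTheory Set Filter Topology Metric Function TopologicalSpace
open scoped ENNReal NNReal InnerProductSpace RealInnerProductSpace Laplacian ContDiff

namespace Summit.NavierStokesRegularity.NavierStokesRegularity.Theorems.PowerGaugeEulerLiouville.FrozenDirection

open Literature.Analysis Literature.Analysis.FunctionSpaces Literature.Analysis.FluidPDE
open Summit.NavierStokesRegularity.NavierStokesRegularity.Theorems.PowerGaugeEulerLiouville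


/-- **Curl-pairs against the frozen direction are annihilated.**  If `G` is a weak gradient of `f` on `ℝ³` with the frozen-direction
pairing `⟪G(x) e, w⟫ = ⟪G(x) w, e⟫` a.e., then `∫ ⟪f, (∂ₐ g) e − (∂ₑ g) a⟫ = 0` for every scalar test function `g` and every `a`.
[folklore] -/
theorem integral_inner_curlPair_eq_zero_of_pairing {f : EuclideanSpace ℝ (Fin 3) → EuclideanSpace ℝ (Fin 3)}
    {G : EuclideanSpace ℝ (Fin 3) → EuclideanSpace ℝ (Fin 3) →L[ℝ] EuclideanSpace ℝ (Fin 3)}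
    (hf : HasWeakGradient f G) {e : EuclideanSpace ℝ (Fin 3)}
    (hpair : ∀ᵐ x ∂(volume : Measure (EuclideanSpace ℝ (Fin 3))), ∀ w : EuclideanSpace ℝ (Fin 3), ⟪G x e, w⟫ = ⟪G x w, e⟫)
    {g : EuclideanSpace ℝ (Fin 3) → ℝ} (hg : IsTestFunctionOn (⊤ : Opens (EuclideanSpace ℝ (Fin 3))) g)
    (a : EuclideanSpace ℝ (Fin 3)) :
    ∫ x, ⟪f x, fderiv ℝ g x a • e - fderiv ℝ g x e • a⟫ = 0 := by
  -- adapted from `integral_inner_curlPair_eq_zero_of_symm` (…IrrotationalTools)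
  have hfl : LocallyIntegrable f volume := locallyIntegrableOn_univ.1 (by
    simpa only [Opens.coe_top] using hf.locallyIntegrableOn)
  have hWe := isTestFunctionOn_smul_const hg e
  have hWa := isTestFunctionOn_smul_const hg a
  have e1 : ∫ x, ⟪f x, fderiv ℝ g x a • e⟫ = -∫ x, g x * ⟪G x a, e⟫ := by
    have h1 := hf.integral_inner_fderiv_apply_test hWe a
    simp_rw [fderiv_smul_const_apply' hg] at h1
    rw [h1]
    congr 1
    refine integral_congr_ae (Eventually.of_forall fun x => ?_)
    simp only [real_inner_smul_right]
  have e2 : ∫ x, ⟪f x, fderiv ℝ g x e • a⟫ = -∫ x, g x * ⟪G x e, a⟫ := by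
    have h1 := hf.integral_inner_fderiv_apply_test hWa e
    simp_rw [fderiv_smul_const_apply' hg] at h1
    rw [h1]
    congr 1
    refine integral_congr_ae (Eventually.of_forall fun x => ?_)
    simp only [real_inner_smul_right]
  have e3 : ∫ x, g x * ⟪G x a, e⟫ = ∫ x, g x * ⟪G x e, a⟫ := by
    refine integral_congr_ae ?_
    filter_upwards [hpair] with x hx
    rw [hx a]
  have i1 : Integrable (fun x => ⟪f x, fderiv ℝ g x a • e⟫) volume := by
    have := integrable_inner_of_locallyIntegrable_of_hasCompactSupport hfl
      ((hWe.contDiff.continuous_fderiv (by simp)).clm_apply continuous_const)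
      (hWe.hasCompactSupport.fderiv_apply (𝕜 := ℝ) a)
    refine this.congr (Eventually.of_forall fun x => ?_)
    simp only [fderiv_smul_const_apply' hg]
  have i2 : Integrable (fun x => ⟪f x, fderiv ℝ g x e • a⟫) volume := by
    have := integrable_inner_of_locallyIntegrable_of_hasCompactSupport hfl
      ((hWa.contDiff.continuous_fderiv (by simp)).clm_apply continuous_const)
      (hWa.hasCompactSupport.fderiv_apply (𝕜 := ℝ) e)
    refine this.congr (Eventually.of_forall fun x => ?_)
    simp only [fderiv_smul_const_apply' hg]
  simp_rw [inner_sub_right]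
  rw [integral_sub i1 i2, e1, e2, e3, sub_self]

/-- **Weak harmonicity of ONE component from weak divergence-freeness and the curl-pairs against that direction.**  Let
`w ∈ L¹_loc(ℝ³; ℝ³)` be weakly divergence free and annihilate the curl-type fields `(∂ₐg) e − (∂ₑ g) a` for every scalar test
function `g` and every `a` (the direction `e` FIXED).  Then `⟪w, e⟫` is weakly harmonic: `∫ Δθ ⟪w, e⟫ = 0`
(the tree's `integral_laplacian_mul_inner_eq_zero_of_curlPair` asks for all pairs `(a, c)`; its proof, copied here, uses only the
pairs `(bᵢ, e)`). [cite: LemarieRieusset2016, proof of Thm. 4.4 pp. 56–57] -/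
theorem integral_laplacian_mul_inner_eq_zero_of_curlPair_dir {w : EuclideanSpace ℝ (Fin 3) → EuclideanSpace ℝ (Fin 3)}
    (hwl : LocallyIntegrable w (volume : Measure (EuclideanSpace ℝ (Fin 3)))) (hdiv : IsWeaklyDivFree w)
    {e : EuclideanSpace ℝ (Fin 3)}
    (hcurl : ∀ g : EuclideanSpace ℝ (Fin 3) → ℝ, IsTestFunctionOn (⊤ : Opens (EuclideanSpace ℝ (Fin 3))) g →
      ∀ a : EuclideanSpace ℝ (Fin 3), ∫ x, ⟪w x, fderiv ℝ g x a • e - fderiv ℝ g x e • a⟫ = 0)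
    {θ : EuclideanSpace ℝ (Fin 3) → ℝ} (hθ : IsTestFunctionOn (⊤ : Opens (EuclideanSpace ℝ (Fin 3))) θ) :
    ∫ x, (Δ θ) x * ⟪w x, e⟫ = 0 := by
  -- adapted from Literature/Analysis/FluidPDE/DivCurlAnnihilator.lean (`integral_laplacian_mul_inner_eq_zero_of_curlPair`)
  set b := stdOrthonormalBasis ℝ (EuclideanSpace ℝ (Fin 3))
  have hθ2 : ContDiff ℝ 2 θ := contDiff_infty.1 hθ.contDiff 2
  have hga : IsTestFunctionOn (⊤ : Opens (EuclideanSpace ℝ (Fin 3))) (fun y => fderiv ℝ θ y e) := hθ.fderiv_apply_const e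
  have hgi : ∀ i, IsTestFunctionOn (⊤ : Opens (EuclideanSpace ℝ (Fin 3))) (fun y => fderiv ℝ θ y (b i)) :=
    fun i => hθ.fderiv_apply_const (b i)
  have hG_smooth : ContDiff ℝ (⊤ : ℕ∞) (gradient fun y => fderiv ℝ θ y e) := by
    refine contDiff_infty.2 fun n => ?_
    exact (InnerProductSpace.toDual ℝ (EuclideanSpace ℝ (Fin 3))).symm.contDiff.comp
      (hga.contDiff.fderiv_right (m := n) (by exact_mod_cast le_top))
  have hG_supp : HasCompactSupport (gradient fun y => fderiv ℝ θ y e) :=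
    (hga.hasCompactSupport.fderiv (𝕜 := ℝ)).comp_left
      (g := (InnerProductSpace.toDual ℝ (EuclideanSpace ℝ (Fin 3))).symm) (map_zero _)
  have iG : Integrable (fun x => ⟪w x, gradient (fun y => fderiv ℝ θ y e) x⟫) volume :=
    integrable_inner_of_locallyIntegrable_of_hasCompactSupport hwl hG_smooth.continuous hG_supp
  have eG : ∫ x, ⟪w x, gradient (fun y => fderiv ℝ θ y e) x⟫ = 0 := hdiv _ hga
  set K : Fin (Module.finrank ℝ (EuclideanSpace ℝ (Fin 3))) → EuclideanSpace ℝ (Fin 3) → EuclideanSpace ℝ (Fin 3) :=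
    fun i x => fderiv ℝ (fun y => fderiv ℝ θ y (b i)) x (b i) • e -
      fderiv ℝ (fun y => fderiv ℝ θ y (b i)) x e • b i with hK_def
  have hKt : ∀ i, IsTestFunctionOn (⊤ : Opens (EuclideanSpace ℝ (Fin 3))) (K i) := fun i =>
    isTestFunctionOn_curlPair (hgi i) (b i) e
  have iK : ∀ i, Integrable (fun x => ⟪w x, K i x⟫) volume := fun i =>
    integrable_inner_of_locallyIntegrable_of_hasCompactSupport hwl (hKt i).contDiff.continuous
      (hKt i).hasCompactSupport
  have eK : ∀ i, ∫ x, ⟪w x, K i x⟫ = 0 := fun i => hcurl _ (hgi i) (b i)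
  have hpt : ∀ x, (Δ θ) x * ⟪w x, e⟫ =
      ⟪w x, gradient (fun y => fderiv ℝ θ y e) x⟫ + ∑ i, ⟪w x, K i x⟫ := fun x => by
    rw [← real_inner_smul_right, laplacian_smul_eq_gradient_add_sum_curlPair b hθ2 e x,
      inner_add_right, inner_sum]
  simp_rw [hpt]
  rw [integral_add iG (integrable_finsetSum _ fun i _ => iK i), integral_finsetSum _ fun i _ => iK i,
    eG, zero_add]
  exact Finset.sum_eq_zero fun i _ => eK i

/-- **THE FROZEN-DIRECTION SLICE LEMMA (F1 of line `frozen-direction`, binder shape of `Sig.stub_noVariationAlongDirection`).**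
A field `f` on `ℝ³` with weak gradient `G` that is trace-free a.e. and satisfies the frozen-direction pairing
`⟪G(x) e, w⟫ = ⟪G(x) w, e⟫` a.e., with sub-volume growth `∫_{B_r}|f|² ≤ K r^m` (`m < 3`, `r > r₀`), does not vary along `e`:
`G(x) e = 0` for a.e. `x`. [folklore; line card `Cruxes/PowerGaugeEulerLiouville/Lines/frozen-direction.md` F1] -/
theorem ae_apply_eq_zero_of_pairing_traceFree_of_growth :
    ∀ (f : EuclideanSpace ℝ (Fin 3) → EuclideanSpace ℝ (Fin 3))
      (G : EuclideanSpace ℝ (Fin 3) → EuclideanSpace ℝ (Fin 3) →L[ℝ] EuclideanSpace ℝ (Fin 3)), HasWeakGradient f G →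
    (∀ᵐ x ∂(volume : Measure (EuclideanSpace ℝ (Fin 3))), ∑ j, G x (EuclideanSpace.single j (1 : ℝ)) j = 0) →
      ∀ e : EuclideanSpace ℝ (Fin 3),
        (∀ᵐ x ∂(volume : Measure (EuclideanSpace ℝ (Fin 3))), ∀ w : EuclideanSpace ℝ (Fin 3), ⟪G x e, w⟫ = ⟪G x w, e⟫) →
        ∀ K m r₀ : ℝ, m < 3 →
          (∀ r : ℝ, r₀ < r → 0 < r →
            ∫⁻ x in ball (0 : EuclideanSpace ℝ (Fin 3)) r, ‖f x‖ₑ ^ 2 ≤ ENNReal.ofReal (K * r ^ m)) →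
            ∀ᵐ x ∂(volume : Measure (EuclideanSpace ℝ (Fin 3))), G x e = 0 := by
  intro f G hf htr e hpair K m r₀ hm hgrowth
  have hfl : LocallyIntegrable f volume := locallyIntegrableOn_univ.1 (by
    simpa only [Opens.coe_top] using hf.locallyIntegrableOn)
  have hGl : ∀ v : EuclideanSpace ℝ (Fin 3), LocallyIntegrable (fun x => G x v) volume := fun v =>
    locallyIntegrableOn_univ.1 (by
      simpa only [Opens.coe_top] using SobolevApprox.locallyIntegrableOn_deriv_apply hf v)
  -- ## (1)–(3): the component `⟪f, e⟫` is weakly harmonic with sub-volume growth, hence zero a.e.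
  have hdiv := isWeaklyDivFree_of_trace_eq_zero hf htr
  have hcurl : ∀ g : EuclideanSpace ℝ (Fin 3) → ℝ, IsTestFunctionOn (⊤ : Opens (EuclideanSpace ℝ (Fin 3))) g →
      ∀ a : EuclideanSpace ℝ (Fin 3), ∫ x, ⟪f x, fderiv ℝ g x a • e - fderiv ℝ g x e • a⟫ = 0 :=
    fun g hg a => integral_inner_curlPair_eq_zero_of_pairing hf hpair hg a
  have hcomp : (fun x => ⟪f x, e⟫) =ᵐ[volume] 0 := by
    refine ae_eq_zero_of_weaklyHarmonic_of_growth (K := ‖e‖ ^ 2 * K) (m := m) (r₀ := r₀) ?_ ?_ hm ?_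
    · have e1 : (fun x => ⟪f x, e⟫) = fun x => (innerSL ℝ e) (f x) := by
        funext x; simp only [innerSL_apply_apply, real_inner_comm]
      rw [e1, ← locallyIntegrableOn_univ]
      exact (innerSL ℝ e).locallyIntegrableOn_comp (locallyIntegrableOn_univ.2 hfl)
    · intro φ hφ hφc
      have hθ : IsTestFunctionOn (⊤ : Opens (EuclideanSpace ℝ (Fin 3))) φ := ⟨hφ, hφc, by simp⟩
      have := integral_laplacian_mul_inner_eq_zero_of_curlPair_dir hfl hdiv hcurl hθ
      rw [← this]
      exact integral_congr_ae (Eventually.of_forall fun x => by simp only [mul_comm])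
    · intro r hr hr0
      have hpt : ∀ x, ‖⟪f x, e⟫‖ₑ ^ 2 ≤ ENNReal.ofReal (‖e‖ ^ 2) * ‖f x‖ₑ ^ 2 := by
        intro x
        rw [← ofReal_norm, ← ofReal_norm, ← ENNReal.ofReal_pow (norm_nonneg _), ← ENNReal.ofReal_pow (norm_nonneg _),
          ← ENNReal.ofReal_mul (sq_nonneg _), ← mul_pow]
        apply ENNReal.ofReal_le_ofReal
        have h1 : ‖⟪f x, e⟫‖ ≤ ‖e‖ * ‖f x‖ := by rw [mul_comm]; exact norm_inner_le_norm _ _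
        exact pow_le_pow_left₀ (norm_nonneg _) h1 2
      calc ∫⁻ x in ball (0 : EuclideanSpace ℝ (Fin 3)) r, ‖⟪f x, e⟫‖ₑ ^ 2
          ≤ ∫⁻ x in ball (0 : EuclideanSpace ℝ (Fin 3)) r, ENNReal.ofReal (‖e‖ ^ 2) * ‖f x‖ₑ ^ 2 :=
            lintegral_mono fun x => hpt x
        _ = ENNReal.ofReal (‖e‖ ^ 2) * ∫⁻ x in ball (0 : EuclideanSpace ℝ (Fin 3)) r, ‖f x‖ₑ ^ 2 :=
            lintegral_const_mul' _ _ ENNReal.ofReal_ne_top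
        _ ≤ ENNReal.ofReal (‖e‖ ^ 2) * ENNReal.ofReal (K * r ^ m) := by gcongr; exact hgrowth r hr hr0
        _ = ENNReal.ofReal (‖e‖ ^ 2 * K * r ^ m) := by rw [← ENNReal.ofReal_mul (sq_nonneg _), mul_assoc]
  -- ## (4): the weak gradient of the vanishing component vanishes: `⟪G w, e⟫ = 0` a.e., each `w`
  have hGw : ∀ w : EuclideanSpace ℝ (Fin 3), ∀ᵐ x ∂(volume : Measure (EuclideanSpace ℝ (Fin 3))), ⟪G x w, e⟫ = 0 := by
    intro w
    have hloc : LocallyIntegrable (fun x => ⟪G x w, e⟫) volume := by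
      have e1 : (fun x => ⟪G x w, e⟫) = fun x => (innerSL ℝ e) (G x w) := by
        funext x; simp only [innerSL_apply_apply, real_inner_comm]
      rw [e1, ← locallyIntegrableOn_univ]
      exact (innerSL ℝ e).locallyIntegrableOn_comp (locallyIntegrableOn_univ.2 (hGl w))
    refine ae_eq_zero_of_integral_contDiff_smul_eq_zero hloc fun g hg hgc => ?_
    have hgt : IsTestFunctionOn (⊤ : Opens (EuclideanSpace ℝ (Fin 3))) g := ⟨hg, hgc, by simp⟩
    have hWe := isTestFunctionOn_smul_const hgt e
    -- `∫ ⟪f, (∂_w g) e⟫ = −∫ g ⟪G w, e⟫`, and the left side vanishes since `⟪f, e⟫ = 0` a.e.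
    have h1 := hf.integral_inner_fderiv_apply_test hWe w
    simp_rw [fderiv_smul_const_apply' hgt] at h1
    have hlhs : ∫ x, ⟪f x, fderiv ℝ g x w • e⟫ = 0 := by
      have hae : (fun x => ⟪f x, fderiv ℝ g x w • e⟫) =ᵐ[volume] fun _ => 0 := by
        filter_upwards [hcomp] with x hx
        simp only [Pi.zero_apply] at hx
        rw [real_inner_smul_right, hx, mul_zero]
      rw [integral_congr_ae hae, integral_zero]
    rw [hlhs] at h1
    have h2 : ∫ x, ⟪G x w, g x • e⟫ = 0 := by linarith
    rw [← h2]
    refine integral_congr_ae (Eventually.of_forall fun x => ?_)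
    simp only [real_inner_smul_right, smul_eq_mul]
  -- ## (5): all directions at once, then the pairing
  set b := EuclideanSpace.basisFun (Fin 3) ℝ with hb
  have hall : ∀ᵐ x ∂(volume : Measure (EuclideanSpace ℝ (Fin 3))), ∀ i : Fin 3, ⟪G x (b i), e⟫ = 0 :=
    ae_all_iff.2 fun i => hGw (b i)
  filter_upwards [hall, hpair] with x hx hpx
  have hGt : ∀ w : EuclideanSpace ℝ (Fin 3), ⟪G x w, e⟫ = 0 := by
    intro w
    have hw : w = ∑ i, w i • b i := by
      conv_lhs => rw [← b.sum_repr w]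
      simp [hb]
    rw [hw, map_sum, sum_inner]
    refine Finset.sum_eq_zero fun i _ => ?_
    rw [map_smul, real_inner_smul_left, hx i, mul_zero]
  have h0 : ⟪G x e, G x e⟫ = 0 := by rw [hpx (G x e)]; exact hGt _
  exact inner_self_eq_zero.1 h0

end Summit.NavierStokesRegularity.NavierStokesRegularity.Theorems.PowerGaugeEulerLiouville.FrozenDirection
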